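import Summits.HubbardSuperconductivity.HubbardSuperconductivity.Theorems.TwTipContinuation.Negative.TipNormalForm
import Literature.MathematicalPhysics.QuantumLattice.SectorEigenvalueContinuation

/-!
# `TwTipContinuation` (stmt-HubbardSuperconductivity-1700) — continuity in the seed, closure of sector
# ground states, and Danskin's one-sided derivatives at the corner `g = 0` (negative-side support, cdisprove gen 3)

Route `ThermalWedge`, crux rank 6. Seeded family `H_L(U,g) = hubbardTorus 2 L 1 U − (g/L²)(ΔᴴΔ)`,
`Δ = pairField dWaveFormFactor L`, sector `szSector (2n) 0`, sector energy `E_L(g) = minEnergyOn`.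
Finite-dimensional facts at ONE side `L`, proved by compactness of the unit sphere and closedness of the
ground-state relation (the eventual-in-`L` corollaries on the route terms are in `Negative/CornerDanskin.lean`):

* `sectorEnergy_sub_le_mul`, `abs_sectorEnergy_sub_le`, `continuous_sectorEnergy` — `g ↦ E_L(g)` is
  `C_d² L²`-Lipschitz;
* `groundState_of_tendsto` — **closure**: if `g_m → g₀`, `ψ_m → ψ₀` and each `ψ_m` is a normalised
  sector ground state of `H_L(U,g_m)`, then `ψ₀` is a normalised sector ground state of `H_L(U,g₀)`;
* `exists_tendsto_subseq_unit` — Bolzano–Weierstrass on the unit sphere of the Fock space;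
* `exists_suppressionCost_of_forall_groundState` — **Danskin, penalty side**
  (`−∂⁻_g E_L(0) = L⁻² min_{GS(0)} ⟨ΔᴴΔ⟩`): if EVERY normalised sector ground state of `H_L(U,0)` has
  `B ≤ re⟨ψ,ΔᴴΔψ⟩` then for every `B' < B` some repulsive seed `−η < 0` costs
  `E_L(−η) − E_L(0) ≥ (η/L²)·B'`;
* `exists_groundState_order_of_uniformSeeds` — **Danskin, attractive side**
  (`−∂⁺_g E_L(0) = L⁻² max_{GS(0)} ⟨ΔᴴΔ⟩ = lim_{g↓0} L⁻² min_{GS(g)} ⟨ΔᴴΔ⟩`): a `g`-UNIFORM every-GS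
  order bound on the seeds `g ∈ (0, g₁]` forces SOME normalised sector ground state of `H_L(U,0)` with
  the same bound — nothing about the other ground states at seed `0`.

Lieb–Wu, Physica A 321 (2003) §2 (variational principle in a sector; "the ground state curve (which is
always continuous)"); Danskin (1966) / Griffiths, J. Math. Phys. 5 (1964) 1215 (one-sided derivatives of
concave ground-state energies); Tasaki (2020) §2.1–2.2. Folklore finite-dimensional analysis; no
definition is introduced.
-/

noncomputable section

namespace Summit.HubbardSuperconductivity.TwTipContinuation.Negative

open Matrix Filter Finset Topology
open Literature.MathematicalPhysics.QuantumLattice Literature.Probability.LatticeModels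
open scoped ComplexOrder

section OneSide

variable {U : ℝ} {L : ℕ} [NeZero L] {n : ℕ}

/-! ### Lipschitz continuity of the sector energy in the seed -/

/-- For `a ≤ b`: `0 ≤ E_L(a) − E_L(b) ≤ (b − a)·C_d²·L²` (left chord at `b` + the crude bound
`re⟨ΔᴴΔ⟩ ≤ C_d² L⁴` on unit vectors). [folklore] -/
theorem sectorEnergy_sub_le_mul (hn : n ≤ Fintype.card (FermionTorus 2 L)) {a b : ℝ} (hab : a ≤ b) :
    (Matrix.minEnergyOn (hubbardTorus 2 L 1 U - ((a / (L : ℝ) ^ 2 : ℝ) : ℂ) • ((pairField dWaveFormFactor L)ᴴ * pairField dWaveFormFactor L)) (szSector (2 * n) 0)) -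
      (Matrix.minEnergyOn (hubbardTorus 2 L 1 U - ((b / (L : ℝ) ^ 2 : ℝ) : ℂ) • ((pairField dWaveFormFactor L)ᴴ * pairField dWaveFormFactor L)) (szSector (2 * n) 0)) ≤
      (b - a) * ((∑ e ∈ insert 0 unitSteps, ‖((dWaveFormFactor e / Real.sqrt 2 : ℝ) : ℂ)‖ * 2) ^ 2 * (L : ℝ) ^ 2) := by
  set C : ℝ := (∑ e ∈ insert 0 unitSteps, ‖((dWaveFormFactor e / Real.sqrt 2 : ℝ) : ℂ)‖ * 2) ^ 2 with hC
  rcases eq_or_lt_of_le hab with rfl | hlt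
  · simp
  obtain ⟨ψ, hψ, hgs⟩ := exists_unit_groundState U b L hn
  have h := leftChord_le_order hlt hψ hgs
  have hP := expect_pairIntensity_le L ψ hψ
  rw [← hC] at hP
  have hL : (0 : ℝ) < (L : ℝ) ^ 2 := by
    have := NeZero.pos L
    positivity
  have hL2 : ((L : ℝ) ^ 2) ≠ 0 := hL.ne'
  calc _ ≤ (b - a) / (L : ℝ) ^ 2 *
        (expect ((pairField dWaveFormFactor L)ᴴ * pairField dWaveFormFactor L) ψ).re := h
    _ ≤ (b - a) / (L : ℝ) ^ 2 * (C * (L : ℝ) ^ 4) :=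
        mul_le_mul_of_nonneg_left hP (div_nonneg (sub_nonneg.2 hab) hL.le)
    _ = (b - a) * (C * (L : ℝ) ^ 2) := by
        rw [div_mul_eq_mul_div, div_eq_iff hL2]
        ring

/-- `|E_L(a) − E_L(b)| ≤ C_d² L² |a − b|`. [folklore] -/
theorem abs_sectorEnergy_sub_le (hn : n ≤ Fintype.card (FermionTorus 2 L)) (a b : ℝ) :
    |(Matrix.minEnergyOn (hubbardTorus 2 L 1 U - ((a / (L : ℝ) ^ 2 : ℝ) : ℂ) • ((pairField dWaveFormFactor L)ᴴ * pairField dWaveFormFactor L)) (szSector (2 * n) 0)) -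
      (Matrix.minEnergyOn (hubbardTorus 2 L 1 U - ((b / (L : ℝ) ^ 2 : ℝ) : ℂ) • ((pairField dWaveFormFactor L)ᴴ * pairField dWaveFormFactor L)) (szSector (2 * n) 0))| ≤
      ((∑ e ∈ insert 0 unitSteps, ‖((dWaveFormFactor e / Real.sqrt 2 : ℝ) : ℂ)‖ * 2) ^ 2 * (L : ℝ) ^ 2) * |a - b| := by
  rcases le_total a b with hab | hba
  · have h1 := sectorEnergy_sub_le_mul (U := U) hn hab
    have h2 : 0 ≤ (Matrix.minEnergyOn (hubbardTorus 2 L 1 U - ((a / (L : ℝ) ^ 2 : ℝ) : ℂ) • ((pairField dWaveFormFactor L)ᴴ * pairField dWaveFormFactor L)) (szSector (2 * n) 0)) -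
      (Matrix.minEnergyOn (hubbardTorus 2 L 1 U - ((b / (L : ℝ) ^ 2 : ℝ) : ℂ) • ((pairField dWaveFormFactor L)ᴴ * pairField dWaveFormFactor L)) (szSector (2 * n) 0)) :=
      sub_nonneg.2 (sectorEnergy_antitone hn hab)
    rw [abs_of_nonneg h2, abs_of_nonpos (sub_nonpos.2 hab)]
    nlinarith [h1]
  · have h1 := sectorEnergy_sub_le_mul (U := U) hn hba
    have h2 : (Matrix.minEnergyOn (hubbardTorus 2 L 1 U - ((a / (L : ℝ) ^ 2 : ℝ) : ℂ) • ((pairField dWaveFormFactor L)ᴴ * pairField dWaveFormFactor L)) (szSector (2 * n) 0)) -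
      (Matrix.minEnergyOn (hubbardTorus 2 L 1 U - ((b / (L : ℝ) ^ 2 : ℝ) : ℂ) • ((pairField dWaveFormFactor L)ᴴ * pairField dWaveFormFactor L)) (szSector (2 * n) 0)) ≤ 0 :=
      sub_nonpos.2 (sectorEnergy_antitone hn hba)
    rw [abs_of_nonpos h2, abs_of_nonneg (sub_nonneg.2 hba)]
    nlinarith [h1]

/-- **`g ↦ E_L(g)` is continuous** (Lipschitz). Lieb–Wu (2003) §2 "the ground state curve (which is
always continuous)". [folklore] -/
theorem continuous_sectorEnergy (hn : n ≤ Fintype.card (FermionTorus 2 L)) :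
    Continuous fun g : ℝ =>
      Matrix.minEnergyOn (hubbardTorus 2 L 1 U - ((g / (L : ℝ) ^ 2 : ℝ) : ℂ) • ((pairField dWaveFormFactor L)ᴴ * pairField dWaveFormFactor L)) (szSector (2 * n) 0) := by
  set C : ℝ := ((∑ e ∈ insert 0 unitSteps, ‖((dWaveFormFactor e / Real.sqrt 2 : ℝ) : ℂ)‖ * 2) ^ 2 * (L : ℝ) ^ 2)
    with hC
  have hC0 : 0 ≤ C := by positivity
  refine (LipschitzWith.of_dist_le_mul (K := ⟨C, hC0⟩) fun a b => ?_).continuous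
  rw [Real.dist_eq, Real.dist_eq]
  exact abs_sectorEnergy_sub_le (U := U) hn a b

/-! ### Closure of the ground-state relation and compactness of the unit sphere -/

/-- **Closure of sector ground states.** If `g_m → g₀`, `ψ_m → ψ₀`, and every `ψ_m` is a normalised
sector ground state of `H_L(U,g_m)`, then `ψ₀` is a normalised sector ground state of `H_L(U,g₀)`
(pass to the limit in `‖ψ_m‖ = 1`, in the coordinate description of the sector, and in the eigen-equation
`H(g_m)ψ_m = E_L(g_m)ψ_m`, using continuity of `E_L`). [folklore] -/
theorem groundState_of_tendsto (hn : n ≤ Fintype.card (FermionTorus 2 L)) {g : ℕ → ℝ} {g₀ : ℝ}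
    (hg : Tendsto g atTop (𝓝 g₀)) {ψ : ℕ → Fock (Orb (FermionTorus 2 L))}
    {ψ₀ : Fock (Orb (FermionTorus 2 L))} (hψ : Tendsto ψ atTop (𝓝 ψ₀))
    (hunit : ∀ m, star (ψ m) ⬝ᵥ ψ m = 1)
    (hgs : ∀ m, IsGroundStateInSector (hubbardTorus 2 L 1 U - ((g m / (L : ℝ) ^ 2 : ℝ) : ℂ) • ((pairField dWaveFormFactor L)ᴴ * pairField dWaveFormFactor L)) (2 * n) 0 (ψ m)) :
    star ψ₀ ⬝ᵥ ψ₀ = 1 ∧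
      IsGroundStateInSector (hubbardTorus 2 L 1 U - ((g₀ / (L : ℝ) ^ 2 : ℝ) : ℂ) • ((pairField dWaveFormFactor L)ᴴ * pairField dWaveFormFactor L)) (2 * n) 0 ψ₀ := by
  -- normalisation passes to the limit
  have hcont : Continuous fun w : Fock (Orb (FermionTorus 2 L)) => star w ⬝ᵥ w := by
    simp only [dotProduct, Pi.star_apply, Complex.star_def]
    fun_prop
  have hunit₀ : star ψ₀ ⬝ᵥ ψ₀ = 1 := by
    have h1 : Tendsto (fun m => star (ψ m) ⬝ᵥ ψ m) atTop (𝓝 (star ψ₀ ⬝ᵥ ψ₀)) :=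
      (hcont.tendsto ψ₀).comp hψ
    have h2 : Tendsto (fun m => star (ψ m) ⬝ᵥ ψ m) atTop (𝓝 1) := by
      simp only [hunit]
      exact tendsto_const_nhds
    exact tendsto_nhds_unique h1 h2
  -- sector membership passes to the limit (coordinate description)
  have hmem : ψ₀ ∈ szSector (Λ := FermionTorus 2 L) (2 * n) (0 : ℝ) := by
    rw [mem_szSector_two_mul_zero_iff]
    intro s hs
    have hco : Tendsto (fun m => ψ m s) atTop (𝓝 (ψ₀ s)) :=
      ((continuous_apply s).tendsto ψ₀).comp hψ
    have hz : (fun m => ψ m s) = fun _ => 0 :=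
      funext fun m => ((mem_szSector_two_mul_zero_iff n (ψ m)).1 (hgs m).1) s hs
    rw [hz] at hco
    exact (tendsto_nhds_unique tendsto_const_nhds hco).symm
  have hne : ψ₀ ≠ 0 := by
    intro h
    rw [h, dotProduct_zero] at hunit₀
    exact zero_ne_one hunit₀
  -- the eigen-equation passes to the limit
  have hE := ((continuous_sectorEnergy (U := U) hn).tendsto g₀).comp hg
  have hform : ∀ (γ : ℝ) (w : Fock (Orb (FermionTorus 2 L))),
      (hubbardTorus 2 L 1 U - ((γ / (L : ℝ) ^ 2 : ℝ) : ℂ) • ((pairField dWaveFormFactor L)ᴴ * pairField dWaveFormFactor L)) *ᵥ w =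
        hubbardTorus 2 L 1 U *ᵥ w -
          ((γ / (L : ℝ) ^ 2 : ℝ) : ℂ) • (((pairField dWaveFormFactor L)ᴴ * pairField dWaveFormFactor L) *ᵥ w) := by
    intro γ w
    rw [sub_mulVec, smul_mulVec]
  have hlhs : Tendsto (fun m => (hubbardTorus 2 L 1 U - ((g m / (L : ℝ) ^ 2 : ℝ) : ℂ) • ((pairField dWaveFormFactor L)ᴴ * pairField dWaveFormFactor L)) *ᵥ ψ m)
      atTop (𝓝 ((hubbardTorus 2 L 1 U - ((g₀ / (L : ℝ) ^ 2 : ℝ) : ℂ) • ((pairField dWaveFormFactor L)ᴴ * pairField dWaveFormFactor L)) *ᵥ ψ₀)) := by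
    simp only [hform]
    have hA : Continuous fun w : Fock (Orb (FermionTorus 2 L)) => hubbardTorus 2 L 1 U *ᵥ w :=
      continuous_const.matrix_mulVec continuous_id
    have hP : Continuous fun w : Fock (Orb (FermionTorus 2 L)) =>
        ((pairField dWaveFormFactor L)ᴴ * pairField dWaveFormFactor L) *ᵥ w :=
      continuous_const.matrix_mulVec continuous_id
    have hc : Tendsto (fun m => (((g m / (L : ℝ) ^ 2 : ℝ)) : ℂ)) atTop (𝓝 (((g₀ / (L : ℝ) ^ 2 : ℝ)) : ℂ)) :=
      (Complex.continuous_ofReal.tendsto _).comp (hg.div_const _)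
    exact ((hA.tendsto ψ₀).comp hψ).sub (hc.smul ((hP.tendsto ψ₀).comp hψ))
  have hrhs : Tendsto (fun m => (((Matrix.minEnergyOn (hubbardTorus 2 L 1 U - ((g m / (L : ℝ) ^ 2 : ℝ) : ℂ) • ((pairField dWaveFormFactor L)ᴴ * pairField dWaveFormFactor L)) (szSector (2 * n) 0) : ℝ)) : ℂ) • ψ m)
      atTop (𝓝 ((((Matrix.minEnergyOn (hubbardTorus 2 L 1 U - ((g₀ / (L : ℝ) ^ 2 : ℝ) : ℂ) • ((pairField dWaveFormFactor L)ᴴ * pairField dWaveFormFactor L)) (szSector (2 * n) 0) : ℝ)) : ℂ) • ψ₀)) :=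
    ((Complex.continuous_ofReal.tendsto _).comp hE).smul hψ
  have heq : (fun m => (hubbardTorus 2 L 1 U - ((g m / (L : ℝ) ^ 2 : ℝ) : ℂ) • ((pairField dWaveFormFactor L)ᴴ * pairField dWaveFormFactor L)) *ᵥ ψ m) =
      fun m => (((Matrix.minEnergyOn (hubbardTorus 2 L 1 U - ((g m / (L : ℝ) ^ 2 : ℝ) : ℂ) • ((pairField dWaveFormFactor L)ᴴ * pairField dWaveFormFactor L)) (szSector (2 * n) 0) : ℝ)) : ℂ) • ψ m :=
    funext fun m => (hgs m).2.2
  rw [heq] at hlhs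
  exact ⟨hunit₀, hmem, hne, tendsto_nhds_unique hlhs hrhs⟩

omit [NeZero L] in
/-- Bolzano–Weierstrass on the unit sphere `{ψ | ⟨ψ,ψ⟩ = 1}` of the Fock space. [folklore] -/
theorem exists_tendsto_subseq_unit {ψ : ℕ → Fock (Orb (FermionTorus 2 L))}
    (hunit : ∀ m, star (ψ m) ⬝ᵥ ψ m = 1) :
    ∃ ψ₀ : Fock (Orb (FermionTorus 2 L)), ∃ φ : ℕ → ℕ, StrictMono φ ∧ Tendsto (ψ ∘ φ) atTop (𝓝 ψ₀) := by
  have hK := EigenvalueContinuation.isCompact_unitSphere_inter (⊤ : Submodule ℂ (Fock (Orb (FermionTorus 2 L))))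
  obtain ⟨ψ₀, -, φ, hφ, hlim⟩ := hK.tendsto_subseq (x := ψ) fun m => ⟨Submodule.mem_top, hunit m⟩
  exact ⟨ψ₀, φ, hφ, hlim⟩

/-! ### Danskin at the corner, penalty side: every-GS order at seed `0` ⇒ a linear suppression cost -/

/-- **Danskin (penalty side).** If EVERY normalised sector ground state `ψ` of `H_L(U,0)` has
`B ≤ re⟨ψ,ΔᴴΔψ⟩`, then for every `B' < B` there is a repulsive seed `−η < 0` with
`(η/L²)·B' ≤ E_L(−η) − E_L(0)`. (Otherwise ground states `ψ_η` of `H_L(U,−η)`, `η ↓ 0`, have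
`re⟨ΔᴴΔ⟩ < B'` by the variational principle at seed `0`; a subsequential limit is a ground state of
`H_L(U,0)` with `re⟨ΔᴴΔ⟩ ≤ B' < B`.) This is `−∂⁻_g E_L(0) = L⁻² min_{GS(0)} ⟨ΔᴴΔ⟩`, the converse of
`everyGSOrder_pure_of_suppressionCost`. Danskin (1966); Griffiths (1966). [folklore] -/
theorem exists_suppressionCost_of_forall_groundState (hn : n ≤ Fintype.card (FermionTorus 2 L))
    {B B' : ℝ} (hB : B' < B)
    (h : ∀ ψ : Fock (Orb (FermionTorus 2 L)), star ψ ⬝ᵥ ψ = 1 →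
      IsGroundStateInSector (hubbardTorus 2 L 1 U - (((0 : ℝ) / (L : ℝ) ^ 2 : ℝ) : ℂ) • ((pairField dWaveFormFactor L)ᴴ * pairField dWaveFormFactor L)) (2 * n) 0 ψ →
        B ≤ (expect ((pairField dWaveFormFactor L)ᴴ * pairField dWaveFormFactor L) ψ).re) :
    ∃ η : ℝ, 0 < η ∧ η / (L : ℝ) ^ 2 * B' ≤
      (Matrix.minEnergyOn (hubbardTorus 2 L 1 U - (((-η) / (L : ℝ) ^ 2 : ℝ) : ℂ) • ((pairField dWaveFormFactor L)ᴴ * pairField dWaveFormFactor L)) (szSector (2 * n) 0)) -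
      (Matrix.minEnergyOn (hubbardTorus 2 L 1 U - (((0 : ℝ) / (L : ℝ) ^ 2 : ℝ) : ℂ) • ((pairField dWaveFormFactor L)ᴴ * pairField dWaveFormFactor L)) (szSector (2 * n) 0)) := by
  by_contra hcon
  simp only [not_exists, not_and, not_le] at hcon
  have hL : (0 : ℝ) < (L : ℝ) ^ 2 := by
    have := NeZero.pos L
    positivity
  -- ground states of the penalised models along `η_m = 1/(m+1)`
  have hex : ∀ m : ℕ, ∃ ψ : Fock (Orb (FermionTorus 2 L)), star ψ ⬝ᵥ ψ = 1 ∧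
      IsGroundStateInSector (hubbardTorus 2 L 1 U - (((-(1 / ((m : ℝ) + 1))) / (L : ℝ) ^ 2 : ℝ) : ℂ) • ((pairField dWaveFormFactor L)ᴴ * pairField dWaveFormFactor L)) (2 * n) 0 ψ :=
    fun m => exists_unit_groundState U _ L hn
  choose ψ hψu hψgs using hex
  -- along the sequence the order is `< B'`
  have hPlt : ∀ m, (expect ((pairField dWaveFormFactor L)ᴴ * pairField dWaveFormFactor L) (ψ m)).re < B' := by
    intro m
    have hη : (0 : ℝ) < 1 / ((m : ℝ) + 1) := by positivity
    have hc := hcon (1 / ((m : ℝ) + 1)) hη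
    obtain ⟨-, hb⟩ := seeded_sector_groundState U 0 L hn
    have v := hb (ψ m) (hψgs m).1 (hψu m)
    have e : (expect (hubbardTorus 2 L 1 U - (((-(1 / ((m : ℝ) + 1))) / (L : ℝ) ^ 2 : ℝ) : ℂ) • ((pairField dWaveFormFactor L)ᴴ * pairField dWaveFormFactor L)) (ψ m)).re =
        Matrix.minEnergyOn (hubbardTorus 2 L 1 U - (((-(1 / ((m : ℝ) + 1))) / (L : ℝ) ^ 2 : ℝ) : ℂ) • ((pairField dWaveFormFactor L)ᴴ * pairField dWaveFormFactor L)) (szSector (2 * n) 0) := by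
      rw [expect_eq_of_groundState L (hψu m) (hψgs m), Complex.ofReal_re]
    have r := expect_seededH_re U (-(1 / ((m : ℝ) + 1))) L 0 (ψ m)
    have key : 1 / ((m : ℝ) + 1) / (L : ℝ) ^ 2 *
        (expect ((pairField dWaveFormFactor L)ᴴ * pairField dWaveFormFactor L) (ψ m)).re <
        1 / ((m : ℝ) + 1) / (L : ℝ) ^ 2 * B' := by
      have hsub : (0 : ℝ) - -(1 / ((m : ℝ) + 1)) = 1 / ((m : ℝ) + 1) := by ring
      rw [hsub] at r
      linarith
    exact lt_of_mul_lt_mul_left key (div_nonneg hη.le hL.le)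
  -- subsequential limit: a ground state of the pure torus with order `≤ B'`
  obtain ⟨ψ₀, φ, hφ, hlim⟩ := exists_tendsto_subseq_unit hψu
  have h1 : Tendsto (fun m => 1 / ((φ m : ℝ) + 1)) atTop (𝓝 (0 : ℝ)) :=
    (tendsto_one_div_add_atTop_nhds_zero_nat (𝕜 := ℝ)).comp hφ.tendsto_atTop
  have hg : Tendsto (fun m => -(1 / ((φ m : ℝ) + 1))) atTop (𝓝 (0 : ℝ)) := by
    simpa using h1.neg
  obtain ⟨hu₀, hgs₀⟩ := groundState_of_tendsto (U := U) hn hg hlim (fun m => hψu (φ m)) (fun m => hψgs (φ m))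
  have hPlim : Tendsto (fun m => (expect ((pairField dWaveFormFactor L)ᴴ * pairField dWaveFormFactor L) (ψ (φ m))).re)
      atTop (𝓝 ((expect ((pairField dWaveFormFactor L)ᴴ * pairField dWaveFormFactor L) ψ₀).re)) :=
    ((EigenvalueContinuation.continuous_energy ((pairField dWaveFormFactor L)ᴴ * pairField dWaveFormFactor L)).tendsto ψ₀).comp hlim
  have hle : (expect ((pairField dWaveFormFactor L)ᴴ * pairField dWaveFormFactor L) ψ₀).re ≤ B' :=
    le_of_tendsto' hPlim fun m => (hPlt (φ m)).le
  have hge := h ψ₀ hu₀ hgs₀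
  linarith

/-! ### Danskin at the corner, attractive side: g-uniform order ⇒ SOME ordered ground state at seed 0 -/

/-- **Danskin (attractive side).** If for all seeds `g ∈ (0, g₁]` EVERY normalised sector ground state
of `H_L(U,g)` has `B ≤ re⟨ψ,ΔᴴΔψ⟩`, then SOME normalised sector ground state of `H_L(U,0)` has
`B ≤ re⟨ψ,ΔᴴΔψ⟩` (subsequential limit of ground states along `g ↓ 0`). This is
`−∂⁺_g E_L(0) = L⁻² max_{GS(0)} ⟨ΔᴴΔ⟩ = lim_{g↓0} L⁻² min_{GS(g)} ⟨ΔᴴΔ⟩`; nothing is asserted about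
the OTHER ground states at seed `0`. Danskin (1966); Griffiths (1966). [folklore] -/
theorem exists_groundState_order_of_uniformSeeds (hn : n ≤ Fintype.card (FermionTorus 2 L))
    {B g₁ : ℝ} (hg₁ : 0 < g₁)
    (h : ∀ g : ℝ, 0 < g → g ≤ g₁ → ∀ ψ : Fock (Orb (FermionTorus 2 L)), star ψ ⬝ᵥ ψ = 1 →
      IsGroundStateInSector (hubbardTorus 2 L 1 U - ((g / (L : ℝ) ^ 2 : ℝ) : ℂ) • ((pairField dWaveFormFactor L)ᴴ * pairField dWaveFormFactor L)) (2 * n) 0 ψ →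
        B ≤ (expect ((pairField dWaveFormFactor L)ᴴ * pairField dWaveFormFactor L) ψ).re) :
    ∃ ψ : Fock (Orb (FermionTorus 2 L)), star ψ ⬝ᵥ ψ = 1 ∧
      IsGroundStateInSector (hubbardTorus 2 L 1 U - (((0 : ℝ) / (L : ℝ) ^ 2 : ℝ) : ℂ) • ((pairField dWaveFormFactor L)ᴴ * pairField dWaveFormFactor L)) (2 * n) 0 ψ ∧
        B ≤ (expect ((pairField dWaveFormFactor L)ᴴ * pairField dWaveFormFactor L) ψ).re := by
  have hex : ∀ m : ℕ, ∃ ψ : Fock (Orb (FermionTorus 2 L)), star ψ ⬝ᵥ ψ = 1 ∧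
      IsGroundStateInSector (hubbardTorus 2 L 1 U - (((g₁ / ((m : ℝ) + 1)) / (L : ℝ) ^ 2 : ℝ) : ℂ) • ((pairField dWaveFormFactor L)ᴴ * pairField dWaveFormFactor L)) (2 * n) 0 ψ :=
    fun m => exists_unit_groundState U _ L hn
  choose ψ hψu hψgs using hex
  have hB : ∀ m, B ≤ (expect ((pairField dWaveFormFactor L)ᴴ * pairField dWaveFormFactor L) (ψ m)).re := by
    intro m
    have hm : (1 : ℝ) ≤ (m : ℝ) + 1 := by
      have := (m.cast_nonneg : (0 : ℝ) ≤ m)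
      linarith
    exact h _ (by positivity) (div_le_self hg₁.le hm) (ψ m) (hψu m) (hψgs m)
  obtain ⟨ψ₀, φ, hφ, hlim⟩ := exists_tendsto_subseq_unit hψu
  have h1 : Tendsto (fun m => 1 / ((φ m : ℝ) + 1)) atTop (𝓝 (0 : ℝ)) :=
    (tendsto_one_div_add_atTop_nhds_zero_nat (𝕜 := ℝ)).comp hφ.tendsto_atTop
  have hg : Tendsto (fun m => g₁ / ((φ m : ℝ) + 1)) atTop (𝓝 (0 : ℝ)) := by
    have h2 := h1.const_mul g₁
    rw [mul_zero] at h2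
    refine h2.congr fun m => ?_
    ring
  obtain ⟨hu₀, hgs₀⟩ := groundState_of_tendsto (U := U) hn hg hlim (fun m => hψu (φ m)) (fun m => hψgs (φ m))
  have hPlim : Tendsto (fun m => (expect ((pairField dWaveFormFactor L)ᴴ * pairField dWaveFormFactor L) (ψ (φ m))).re)
      atTop (𝓝 ((expect ((pairField dWaveFormFactor L)ᴴ * pairField dWaveFormFactor L) ψ₀).re)) :=
    ((EigenvalueContinuation.continuous_energy ((pairField dWaveFormFactor L)ᴴ * pairField dWaveFormFactor L)).tendsto ψ₀).comp hlim
  exact ⟨ψ₀, hu₀, hgs₀, ge_of_tendsto' hPlim fun m => hB (φ m)⟩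

end OneSide

end Summit.HubbardSuperconductivity.TwTipContinuation.Negative
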